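import Summits.BirchSwinnertonDyer.Rank1Residual.Partition.CornersMultSchneiderCellC
import Summits.BirchSwinnertonDyer.Rank1Residual.X2.GreenbergVatsalOfDerivedProp510
import Summits.BirchSwinnertonDyer.Rank1Residual.X2.ClassClosureOfDerivedF0
import HarnessLib

/-!
# The MULTIPLICATIVE axis after the X2a closure of record: in rank `0` the §C corner is
# X11a ∨ X2b, and in rank `≤ 1` modulo the pair's Schneider certificate the X2 corner shrinks on
# BOTH ranks (cell `b2b-bsdres`, RESIDUAL-MAP.md §C row 'X2' / §I N9 after referee A ROUND 199
# R199.2 (tier) and ROUND 201 R201.2 (booking of the lane offer `T-GV00-X2A`); rmap-1 gen 9)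

HONEST FRAMING (run/shared/lean/b2b/bsd-rank1-residual/, verbatim in every file): the goal of the
cell is to DELETE the COMBINATION-SHAPED residual classes of the Birch–Swinnerton-Dyer formula for
ALL analytic-rank `≤ 1` elliptic curves over `ℚ` — "full BSD formula for every rank `≤ 1` curve in
class `C`" assembled STRICTLY from published theorems — so that the rank-`≤ 1` remainder becomes
exactly the CONSTRUCTION-SHAPED classes, which are TYPED (missing-input `Prop`s), NOT attempted.
This is not "finishing BSD". Theorems only; NO definition, NO named fact introduced here; every
published theorem enters as one of the tree's existing named Literature facts BY NAME; nothing
about any particular curve is asserted; no label changes; nothing is booked by this file (the X2a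
cells were booked by referee A on the lane's offer; this file only restates the block's corner
predicate in kernel form).

## What this file records

`Partition/Corners.lean` (rmap-1 gen 2) closes the multiplicative axis in rank `0` outside the
corners X11a ('(ram) fails') and X2 (`E[p]` reducible) by Skinner 2016 Thm. C. The X2 sub-cell
X2a = `X2.CellA W p` (`r_an = 0 ∧ ClassX2 W p ∧ GVPar W p`: some rational `p`-isogeny line is
ramified-at-`p`-and-even or unramified-at-`p`-and-odd — the Greenberg–Vatsal parity) has a closure
of record on the tree: `X2.TargetA` (`∀ W p, CellA W p → BSDp W p`), PROVED from twenty registered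
published facts by eisenstein-p2's
`X2.GreenbergVatsalOfDerivedProp510.targetA_of_derivedFacts` (p261163; Greenberg–Vatsal 2000
Thm. (3.11) + (28) at a good-ordinary-or-multiplicative prime, Greenberg LNM 1716 Prop. 5.10
DERIVED, Wuthrich 2014 Thm. 16, Stein–Wuthrich 2013 Thm. 6.1, Tate uniformisation, modularity,
GZK, Greenberg–Stevens) — referee A R199.2 moved X2a's tier to COVERED (PUB) on that term and
R201.2 booked the 59 residue cells at `p = 3`. This file lifts it to the Partition level, the
shape of RESIDUAL-MAP §C's corner predicate:

* `bsdp_mult_rankZero_of_targetA` — **odd multiplicative `p`, `r = 0`: `BSD(E,p)` unless X11a or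
  X2b (`ClassX2 ∧ ¬GVPar`)**, from Skinner Thm. C (three facts) and `X2.TargetA` taken as ONE
  hypothesis; `bsdp_mult_rankZero_of_derivedFacts` — the same with `TargetA` discharged by its
  twenty registered facts (twenty-one named facts in all: `hmod`, `hGZK` are shared); partition
  form `bsdp_or_corner_mult_rankZero_of_targetA`;
* `bsdp_mult_of_schneider_sharp_targetA` — **odd multiplicative `p`, `r ≤ 1`, the pair's Schneider
  certificate: `BSD(E,p)` unless X11a, or X2 OUTSIDE both its rank-`0` GV-parity part (X2a) and
  its rank-`1` non-split GV-parity part, or X11b off the `p`-adic lever's locus** — cc-typer-6's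
  `bsdp_mult_of_schneider_sharp_cellC` (twelve facts) with `X2.TargetA`; partition form
  `bsdp_or_corner_mult_of_schneider_targetA`; `…_of_derivedFacts` with `TargetA` and the
  Greenberg–Vatsal multiplicative clause `lambdaMu_multiplicative_of_gvPar` BOTH discharged from
  registered facts (`lambdaMu_multiplicative_of_gvPar_of_derivedFacts`) — twenty-three named facts
  + the two certificate binders.

So, on the multiplicative axis, what the published record (as typed on the tree) does NOT reach is
exactly: X11a; X2 with the "wrong" Greenberg–Vatsal parity (X2b in rank `0`; in rank `1` the
¬gvpar pairs and the split pairs = §I O9's typed residue); X11b without a (ram) witness or split at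
`p = 3`; and, everywhere in rank `1`, the per-pair Schneider certificate. Census of record
(referee A R201.3 / the lane's `class-closure/N9/E2-hypotheses.tsv`): the rank-`0` X2 residue at
`N < 5·10⁵` is 127 cells, all at `p = 3`, all X2b (83 split + 44 non-split).

References: C. Skinner, Pacific J. Math. 283 (2016) Thm. C; R. Greenberg, V. Vatsal, Invent.
Math. 142 (2000) Thm. (1.3), §3 Thm. (3.11); R. Greenberg, LNM 1716 (1999) Prop. 5.10;
C. Wuthrich, Doc. Math. 19 (2014) Thm. 16; W. Stein, C. Wuthrich, Math. Comp. 82 (2013) Thm. 6.1;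
D. Disegni, Kyoto J. Math. 60 (2020) Thm. 1; referee A `pub/pub-bsdpct/REFEREE.md` ROUND 199
R199.2, ROUND 201 R201.2.
-/

namespace Summit.BirchSwinnertonDyer.Rank1Residual

open WeierstrassCurve Literature.NumberTheory.EllipticCurves
  Literature.NumberTheory.EllipticCurves.Rank1Residual Literature.NumberTheory.EllipticCurves.ModularForms
  Literature.NumberTheory.EllipticCurves.Wuthrich2014
  Literature.NumberTheory.EllipticCurves.GreenbergVatsal2000
  Literature.NumberTheory.EllipticCurves.Rank1Residual.Typed
  Literature.NumberTheory.EllipticCurves.Skinner2016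
  Literature.NumberTheory.EllipticCurves.SteinWuthrich2013
  Literature.NumberTheory.EllipticCurves.Disegni2020
open scoped NumberField ModularForm

section Curve

variable {W : WeierstrassCurve ℚ} [W.IsElliptic] [W.IsGloballyMinimal] {p : ℕ} [Fact p.Prime]

/-! ### Rank `0`: the corner is X11a ∨ X2b -/

/-- **MULTIPLICATIVE axis, rank `0`, after the X2a closure: `BSD(E,p)` unless X11a or X2b.** At an
odd multiplicative `p`, a curve of analytic rank `0` satisfies `BSD(E,p)` unless `(E,p)` lies in
X11a (irreducible, no (ram) witness) or in X2b (`E[p]` reducible with ¬(GV parity)): irreducible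
∧ (ram) by Skinner 2016 Thm. C (`hSk`, `Corners.bsdp_mult_rankZero_of_not_corner`); reducible ∧
gvpar by the X2a closure `X2.TargetA` (`hTA`, ONE hypothesis — a theorem from twenty registered
facts, `X2.GreenbergVatsalOfDerivedProp510.targetA_of_derivedFacts`). RESIDUAL-MAP §C X2 row /
§I N9 in kernel form. [folklore] -/
theorem bsdp_mult_rankZero_of_targetA (hSk : Skinner2016.thmC_padicValRat_bsd_rank_zero)
    (hmod : hasEntireLFunction_rat) (hGZK : rank_eq_analyticRank_of_analyticRank_le_one)
    (hTA : X2.TargetA) (hp : p ≠ 2) (hm : Mult W p) (hr0 : W.analyticRank = 0)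
    (hX11a : ¬ ClassX11a W p) (hX2b : ¬ (ClassX2 W p ∧ ¬ GVPar W p)) : BSDp W p := by
  by_cases hX2 : ClassX2 W p
  · have hgv : GVPar W p := by
      by_contra h
      exact hX2b ⟨hX2, h⟩
    exact hTA W p ⟨hr0, hX2, hgv⟩
  · exact bsdp_mult_rankZero_of_not_corner hSk hmod hGZK hp hm hr0 hX11a hX2

/-- **Partition form, multiplicative axis, rank `0`, after the X2a closure:
`BSD(E,p) ∨ X11a ∨ X2b`.** [folklore] -/
theorem bsdp_or_corner_mult_rankZero_of_targetA (hSk : Skinner2016.thmC_padicValRat_bsd_rank_zero)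
    (hmod : hasEntireLFunction_rat) (hGZK : rank_eq_analyticRank_of_analyticRank_le_one)
    (hTA : X2.TargetA) (hp : p ≠ 2) (hm : Mult W p) (hr0 : W.analyticRank = 0) :
    BSDp W p ∨ ClassX11a W p ∨ (ClassX2 W p ∧ ¬ GVPar W p) := by
  by_cases hX11a : ClassX11a W p
  · exact Or.inr (Or.inl hX11a)
  · by_cases hX2b : ClassX2 W p ∧ ¬ GVPar W p
    · exact Or.inr (Or.inr hX2b)
    · exact Or.inl (bsdp_mult_rankZero_of_targetA hSk hmod hGZK hTA hp hm hr0 hX11a hX2b)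

/-- **MULTIPLICATIVE axis, rank `0`, after the X2a closure, from registered facts only: TWENTY-ONE
named facts** — Skinner 2016 Thm. C (`hSk`) and the twenty binders of
`X2.GreenbergVatsalOfDerivedProp510.targetA_of_derivedFacts` (Tate uniformisation ×2, the
Greenberg–Vatsal §2–§3 facts at a multiplicative prime, Wuthrich 2014 Thm. 16, Stein–Wuthrich 2013
Thm. 6.1 ×2 + the §4.2 height existence ×2, GZK, modularity ×2, Greenberg–Stevens); `BSD(E,p)`
unless X11a or X2b. [folklore] -/
theorem bsdp_mult_rankZero_of_derivedFacts (hSk : Skinner2016.thmC_padicValRat_bsd_rank_zero)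
    (hT : Silverman1994_thmV53_tateUniformisation.{0})
    (hT' : Silverman1994_thmV53_corV54_tateUniformisation.{0})
    (hΛ : lambda_nonPrimitive_eq_add_sum_delta_multiplicative)
    (hB : datumSelmer_divisible_of_finite_torsionBy)
    (hF : datumStrictSelmer_lt_datumSelmer_of_split)
    (hLiftF : residualEpsilon_surjOn_of_lineRamifiedEven)
    (hP : cor38_realPeriodRat_eq_unit_mul_of_isIsogenous_of_gvPar)
    (hEx : exists_characterLFunction)
    (h311 : thm311_hasUnitContent_iff_and_order_eq_of_lineRamifiedEven)
    (hLC : characterLFunctionC_hasUnitContent_and_order_eq_card)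
    (hLD : characterLFunctionD_hasUnitContent_and_order_eq_card)
    (hWu : thm16_charIdeal_dvd_multiplicative_of_reducible)
    (hJs : thm61_splitMultiplicative) (hJn : thm61_nonsplitMultiplicative)
    (hHs : exists_isSplitMultCanonical) (hHn : exists_isMultCanonical)
    (hGZK : rank_eq_analyticRank_of_analyticRank_le_one) (hmod : hasEntireLFunction_rat)
    (hpar : nonempty_modularParametrizationData)
    (hGS : ∀ (W : WeierstrassCurve ℚ) [W.IsElliptic] [W.IsGloballyMinimal] (p : ℕ) [Fact p.Prime],
      greenberg_stevens (W := W) (p := p))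
    (hp : p ≠ 2) (hm : Mult W p) (hr0 : W.analyticRank = 0)
    (hX11a : ¬ ClassX11a W p) (hX2b : ¬ (ClassX2 W p ∧ ¬ GVPar W p)) : BSDp W p :=
  bsdp_mult_rankZero_of_targetA hSk hmod hGZK
    (X2.GreenbergVatsalOfDerivedProp510.targetA_of_derivedFacts hT hT' hΛ hB hF hLiftF hP hEx h311
      hLC hLD hWu hJs hJn hHs hHn hGZK hmod hpar hGS)
    hp hm hr0 hX11a hX2b

/-! ### Rank `≤ 1` modulo the Schneider certificate: the X2 corner shrinks on both ranks -/

/-- **SHARP MODULO THE SCHNEIDER CERTIFICATE, multiplicative axis, rank `≤ 1`, X2 shrunk on BOTH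
ranks.** For every `E/ℚ` (globally minimal `W`) of analytic rank `≤ 1` and every ODD prime `p` of
MULTIPLICATIVE reduction carrying the pair's Schneider certificate (`hSchN` / `hSchS`, idle in rank
`0`), `BSD(E,p)` holds unless `(E,p)` lies in X11a, or in X2 OUTSIDE both the rank-`0` GV-parity
sub-cell X2a (closed by `X2.TargetA`, `hTA`) and the rank-`1` non-split GV-parity sub-cell
(closed modulo the certificate by cc-typer-6's lever, `bsdp_mult_of_schneider_sharp_cellC`, with
the Greenberg–Vatsal multiplicative clause `hGV`), or in X11b OFF the `p`-adic lever's locus.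
[folklore] -/
theorem bsdp_mult_of_schneider_sharp_targetA (hSk : Skinner2016.thmC_padicValRat_bsd_rank_zero)
    (hmod : hasEntireLFunction_rat) (hGZK : rank_eq_analyticRank_of_analyticRank_le_one)
    (hA : thmA_charIdeal_multiplicative)
    (hJn : thm61_nonsplitMultiplicative) (hJs : thm61_splitMultiplicative)
    (hHn : exists_isMultCanonical) (hHs : exists_isSplitMultCanonical)
    (hD : thm1_padicBSD_rankOne_multiplicative) (hpar : nonempty_modularParametrizationData)
    (hGV : lambdaMu_multiplicative_of_gvPar) (hWu : thm16_charIdeal_dvd_multiplicative_of_reducible)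
    (hTA : X2.TargetA) (hp : p ≠ 2) (hm : Mult W p) (hr : W.analyticRank ≤ 1)
    (hSchN : ∀ (q : ℚ_[p]) (Dh : PAdicHeightData W p), q ≠ 0 → ‖q‖ < 1 → tateJ q = (W.j : ℚ_[p]) →
      IsMultCanonical Dh q → SchneiderConjecture Dh)
    (hSchS : ∀ (Dq : TateParameterData W p) (Dh : PAdicHeightData W p),
      IsSplitMultCanonical Dh Dq → SchneiderConjecture Dh)
    (hX11a : ¬ ClassX11a W p)
    (hX2 : ¬ (ClassX2 W p ∧ ¬ (W.analyticRank = 0 ∧ GVPar W p) ∧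
      ¬ (W.analyticRank = 1 ∧ ¬ W.HasSplitMultiplicativeReductionAtPrime p ∧ GVPar W p)))
    (hlev : ¬ (ClassX11b W p ∧ ¬ (Ram W p ∧ (W.HasSplitMultiplicativeReductionAtPrime p → 5 ≤ p)))) :
    BSDp W p := by
  by_cases hA0 : ClassX2 W p ∧ (W.analyticRank = 0 ∧ GVPar W p)
  · exact hTA W p ⟨hA0.2.1, hA0.1, hA0.2.2⟩
  · refine bsdp_mult_of_schneider_sharp_cellC hSk hmod hGZK hA hJn hJs hHn hHs hD hpar hGV hWu hp hm hr
      hSchN hSchS hX11a ?_ hlev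
    rintro ⟨hX2', hnot⟩
    exact hX2 ⟨hX2', fun h0 => hA0 ⟨hX2', h0⟩, hnot⟩

/-- **Partition form on the multiplicative axis, rank `≤ 1`, modulo the certificate, X2 shrunk on
both ranks: `BSD(E,p) ∨ X11a ∨ (X2 ∧ ¬(r = 0 ∧ gvpar) ∧ ¬(r = 1 ∧ ¬split ∧ gvpar)) ∨ (X11b off the
lever's locus)`.** [folklore] -/
theorem bsdp_or_corner_mult_of_schneider_targetA (hSk : Skinner2016.thmC_padicValRat_bsd_rank_zero)
    (hmod : hasEntireLFunction_rat) (hGZK : rank_eq_analyticRank_of_analyticRank_le_one)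
    (hA : thmA_charIdeal_multiplicative)
    (hJn : thm61_nonsplitMultiplicative) (hJs : thm61_splitMultiplicative)
    (hHn : exists_isMultCanonical) (hHs : exists_isSplitMultCanonical)
    (hD : thm1_padicBSD_rankOne_multiplicative) (hpar : nonempty_modularParametrizationData)
    (hGV : lambdaMu_multiplicative_of_gvPar) (hWu : thm16_charIdeal_dvd_multiplicative_of_reducible)
    (hTA : X2.TargetA) (hp : p ≠ 2) (hm : Mult W p) (hr : W.analyticRank ≤ 1)
    (hSchN : ∀ (q : ℚ_[p]) (Dh : PAdicHeightData W p), q ≠ 0 → ‖q‖ < 1 → tateJ q = (W.j : ℚ_[p]) →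
      IsMultCanonical Dh q → SchneiderConjecture Dh)
    (hSchS : ∀ (Dq : TateParameterData W p) (Dh : PAdicHeightData W p),
      IsSplitMultCanonical Dh Dq → SchneiderConjecture Dh) :
    BSDp W p ∨ ClassX11a W p ∨
      (ClassX2 W p ∧ ¬ (W.analyticRank = 0 ∧ GVPar W p) ∧
        ¬ (W.analyticRank = 1 ∧ ¬ W.HasSplitMultiplicativeReductionAtPrime p ∧ GVPar W p)) ∨
      (ClassX11b W p ∧ ¬ (Ram W p ∧ (W.HasSplitMultiplicativeReductionAtPrime p → 5 ≤ p))) := by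
  by_cases hX11a : ClassX11a W p
  · exact Or.inr (Or.inl hX11a)
  · by_cases hX2 : ClassX2 W p ∧ ¬ (W.analyticRank = 0 ∧ GVPar W p) ∧
        ¬ (W.analyticRank = 1 ∧ ¬ W.HasSplitMultiplicativeReductionAtPrime p ∧ GVPar W p)
    · exact Or.inr (Or.inr (Or.inl hX2))
    · by_cases hlev : ClassX11b W p ∧ ¬ (Ram W p ∧ (W.HasSplitMultiplicativeReductionAtPrime p → 5 ≤ p))
      · exact Or.inr (Or.inr (Or.inr hlev))
      · exact Or.inl (bsdp_mult_of_schneider_sharp_targetA hSk hmod hGZK hA hJn hJs hHn hHs hD hpar hGV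
          hWu hTA hp hm hr hSchN hSchS hX11a hX2 hlev)

/-- **The same, from registered facts only: TWENTY-THREE named facts + the two certificate
binders.** `X2.TargetA` and the Greenberg–Vatsal multiplicative clause
`lambdaMu_multiplicative_of_gvPar` are BOTH discharged from eisenstein-p2's derived-facts terms
(`targetA_of_derivedFacts`, `lambdaMu_multiplicative_of_gvPar_of_derivedFacts`; Greenberg Prop.
5.10 derived, GV Thm. (3.11) + (28) at a good-ordinary-or-multiplicative prime). `BSD(E,p)` at an
odd multiplicative `p` in analytic rank `≤ 1`, modulo the pair's Schneider certificate, unless X11a,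
or X2 outside its two GV-parity sub-cells, or X11b off the lever's locus. [folklore] -/
theorem bsdp_mult_of_schneider_sharp_of_derivedFacts
    (hSk : Skinner2016.thmC_padicValRat_bsd_rank_zero) (hA : thmA_charIdeal_multiplicative)
    (hD : thm1_padicBSD_rankOne_multiplicative)
    (hT : Silverman1994_thmV53_tateUniformisation.{0})
    (hT' : Silverman1994_thmV53_corV54_tateUniformisation.{0})
    (hΛ : lambda_nonPrimitive_eq_add_sum_delta_multiplicative)
    (hB : datumSelmer_divisible_of_finite_torsionBy)
    (hF : datumStrictSelmer_lt_datumSelmer_of_split)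
    (hLiftF : residualEpsilon_surjOn_of_lineRamifiedEven)
    (hP : cor38_realPeriodRat_eq_unit_mul_of_isIsogenous_of_gvPar)
    (hEx : exists_characterLFunction)
    (h311 : thm311_hasUnitContent_iff_and_order_eq_of_lineRamifiedEven)
    (hLC : characterLFunctionC_hasUnitContent_and_order_eq_card)
    (hLD : characterLFunctionD_hasUnitContent_and_order_eq_card)
    (hWu : thm16_charIdeal_dvd_multiplicative_of_reducible)
    (hJs : thm61_splitMultiplicative) (hJn : thm61_nonsplitMultiplicative)
    (hHs : exists_isSplitMultCanonical) (hHn : exists_isMultCanonical)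
    (hGZK : rank_eq_analyticRank_of_analyticRank_le_one) (hmod : hasEntireLFunction_rat)
    (hpar : nonempty_modularParametrizationData)
    (hGS : ∀ (W : WeierstrassCurve ℚ) [W.IsElliptic] [W.IsGloballyMinimal] (p : ℕ) [Fact p.Prime],
      greenberg_stevens (W := W) (p := p))
    (hp : p ≠ 2) (hm : Mult W p) (hr : W.analyticRank ≤ 1)
    (hSchN : ∀ (q : ℚ_[p]) (Dh : PAdicHeightData W p), q ≠ 0 → ‖q‖ < 1 → tateJ q = (W.j : ℚ_[p]) →
      IsMultCanonical Dh q → SchneiderConjecture Dh)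
    (hSchS : ∀ (Dq : TateParameterData W p) (Dh : PAdicHeightData W p),
      IsSplitMultCanonical Dh Dq → SchneiderConjecture Dh)
    (hX11a : ¬ ClassX11a W p)
    (hX2 : ¬ (ClassX2 W p ∧ ¬ (W.analyticRank = 0 ∧ GVPar W p) ∧
      ¬ (W.analyticRank = 1 ∧ ¬ W.HasSplitMultiplicativeReductionAtPrime p ∧ GVPar W p)))
    (hlev : ¬ (ClassX11b W p ∧ ¬ (Ram W p ∧ (W.HasSplitMultiplicativeReductionAtPrime p → 5 ≤ p)))) :
    BSDp W p :=
  bsdp_mult_of_schneider_sharp_targetA hSk hmod hGZK hA hJn hJs hHn hHs hD hpar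
    (X2.GreenbergVatsalOfDerivedProp510.lambdaMu_multiplicative_of_gvPar_of_derivedFacts hT hT' hΛ hB
      hF hLiftF hP hEx h311 hLC hLD hWu)
    hWu
    (X2.GreenbergVatsalOfDerivedProp510.targetA_of_derivedFacts hT hT' hΛ hB hF hLiftF hP hEx h311
      hLC hLD hWu hJs hJn hHs hHn hGZK hmod hpar hGS)
    hp hm hr hSchN hSchS hX11a hX2 hlev

/-! ### Appended (rmap-1 gen 9, after eisenstein-p2's `X2/ClassClosureOfDerivedF0`, referee b2b
R143.3): the X2a closure term with F0 DISCHARGED and HEIGHT-FREE — EIGHTEEN named facts. -/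

/-- **Multiplicative axis, rank `0`, odd `p`, after the X2a closure — EIGHTEEN named facts, no typed
input, no certificate**: `bsdp_mult_rankZero_of_derivedFacts` with `X2.TargetA` supplied by
eisenstein-p2's `ClassClosureOfDerivedF0.targetA_of_derivedF0_heightFree` — the Kubota–Leopoldt /
character `p`-adic L-function existence fact `exists_characterLFunction` (A223) is now the THEOREM
`exists_characterLFunction_holds`, and the rank-`0` closure needs no Stein–Wuthrich §4.2 height
datum (`exists_isSplitMultCanonical` / `exists_isMultCanonical` dropped). `BSD(E,p)` unless
`X11a ∨ X2b`. [cite: Skinner2016PacificMC, Thm. C] [cite: GreenbergVatsal2000, Thm. (1.3), §3 Thm. (3.11)]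
[cite: Wuthrich2014, Thm. 16 (p. 397)] -/
theorem bsdp_mult_rankZero_of_derivedF0 (hSk : Skinner2016.thmC_padicValRat_bsd_rank_zero)
    (hT : Silverman1994_thmV53_tateUniformisation.{0})
    (hT' : Silverman1994_thmV53_corV54_tateUniformisation.{0})
    (hΛ : lambda_nonPrimitive_eq_add_sum_delta_multiplicative)
    (hB : datumSelmer_divisible_of_finite_torsionBy)
    (hF : datumStrictSelmer_lt_datumSelmer_of_split)
    (hLiftF : residualEpsilon_surjOn_of_lineRamifiedEven)
    (hP : cor38_realPeriodRat_eq_unit_mul_of_isIsogenous_of_gvPar)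
    (h311 : thm311_hasUnitContent_iff_and_order_eq_of_lineRamifiedEven)
    (hLC : characterLFunctionC_hasUnitContent_and_order_eq_card)
    (hLD : characterLFunctionD_hasUnitContent_and_order_eq_card)
    (hWu : thm16_charIdeal_dvd_multiplicative_of_reducible)
    (hJs : thm61_splitMultiplicative) (hJn : thm61_nonsplitMultiplicative)
    (hGZK : rank_eq_analyticRank_of_analyticRank_le_one) (hmod : hasEntireLFunction_rat)
    (hpar : nonempty_modularParametrizationData)
    (hGS : ∀ (W : WeierstrassCurve ℚ) [W.IsElliptic] [W.IsGloballyMinimal] (p : ℕ) [Fact p.Prime],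
      greenberg_stevens (W := W) (p := p))
    (hp : p ≠ 2) (hm : Mult W p) (hr0 : W.analyticRank = 0)
    (hX11a : ¬ ClassX11a W p) (hX2b : ¬ (ClassX2 W p ∧ ¬ GVPar W p)) : BSDp W p :=
  bsdp_mult_rankZero_of_targetA hSk hmod hGZK
    (X2.ClassClosureOfDerivedF0.targetA_of_derivedF0_heightFree hT hT' hΛ hB hF hLiftF hP h311 hLC hLD
      hWu hJs hJn hGZK hmod hpar hGS)
    hp hm hr0 hX11a hX2b

/-- **Partition form, multiplicative axis, rank `0`, eighteen named facts: `BSD(E,p) ∨ X11a ∨ X2b`.**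
[folklore] -/
theorem bsdp_or_corner_mult_rankZero_of_derivedF0 (hSk : Skinner2016.thmC_padicValRat_bsd_rank_zero)
    (hT : Silverman1994_thmV53_tateUniformisation.{0})
    (hT' : Silverman1994_thmV53_corV54_tateUniformisation.{0})
    (hΛ : lambda_nonPrimitive_eq_add_sum_delta_multiplicative)
    (hB : datumSelmer_divisible_of_finite_torsionBy)
    (hF : datumStrictSelmer_lt_datumSelmer_of_split)
    (hLiftF : residualEpsilon_surjOn_of_lineRamifiedEven)
    (hP : cor38_realPeriodRat_eq_unit_mul_of_isIsogenous_of_gvPar)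
    (h311 : thm311_hasUnitContent_iff_and_order_eq_of_lineRamifiedEven)
    (hLC : characterLFunctionC_hasUnitContent_and_order_eq_card)
    (hLD : characterLFunctionD_hasUnitContent_and_order_eq_card)
    (hWu : thm16_charIdeal_dvd_multiplicative_of_reducible)
    (hJs : thm61_splitMultiplicative) (hJn : thm61_nonsplitMultiplicative)
    (hGZK : rank_eq_analyticRank_of_analyticRank_le_one) (hmod : hasEntireLFunction_rat)
    (hpar : nonempty_modularParametrizationData)
    (hGS : ∀ (W : WeierstrassCurve ℚ) [W.IsElliptic] [W.IsGloballyMinimal] (p : ℕ) [Fact p.Prime],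
      greenberg_stevens (W := W) (p := p))
    (hp : p ≠ 2) (hm : Mult W p) (hr0 : W.analyticRank = 0) :
    BSDp W p ∨ ClassX11a W p ∨ (ClassX2 W p ∧ ¬ GVPar W p) := by
  by_cases hX11a : ClassX11a W p
  · exact Or.inr (Or.inl hX11a)
  by_cases hX2b : ClassX2 W p ∧ ¬ GVPar W p
  · exact Or.inr (Or.inr hX2b)
  exact Or.inl (bsdp_mult_rankZero_of_derivedF0 hSk hT hT' hΛ hB hF hLiftF hP h311 hLC hLD hWu hJs hJn
    hGZK hmod hpar hGS hp hm hr0 hX11a hX2b)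

end Curve

end Summit.BirchSwinnertonDyer.Rank1Residual
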